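import Mathlib.Geometry.Manifold.Instances.Sphere
import Mathlib.Analysis.InnerProductSpace.Calculus
import HarnessLib

/-!
# Sphere geometry for the `E₈` plumbing: reflections, transport rotations and the plumbing
# involution of `Sᵏ × Sᵏ`

Topic `Literature/Topology/FourManifolds`; geometric groundwork for the construction of Kosinski's
plumbing `M(4m)` (A. Kosinski, *Differential Manifolds* (1993), VI.12: eight copies of the tangent
disc bundle of `S²ᵐ` plumbed along the `E₈` tree), fact seat of
`Literature.Topology.FourManifolds.HomotopySphere.exists_intersectionForm_equivalent_e8Form`.
The disc bundle of `TSᵏ` is realised as the tube `{⟪p, q⟫ > c}` of the diagonal of `Sᵏ × Sᵏ`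
(Milnor–Stasheff, *Characteristic classes* (1974), Lemma 11.5; tree file
`SphereProductTube.lean`), with base point `p` and fibre point `q`. Plumbing two such tubes at
a pole `e ∈ Sᵏ` means identifying a neighbourhood of the fibre over `e` in one tube with a
neighbourhood of the base disc around `e` in the other, interchanging base and fibre
(Kosinski VI.12, p. 120: "identify `D₁ᵏ × Dᵏ` with `Dᵏ × D₂ᵏ` by `(x, y) ↦ (y, x)`"). Here this
identification is written **chart-free** by transport rotations:

* `Plumbing.refl v` — the reflection `x ↦ x - (2⟪v, x⟫/⟪v, v⟫) v` in `v^⊥` of a real inner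
  product space: an involutive isometry, smooth in `(v, x)` off `v = 0`;
* `Plumbing.rotTo p e = refl e ∘ refl (p + e)` — for `‖p‖ = ‖e‖`, `p ≠ -e`, the rotation of
  the plane `⟨p, e⟩` taking `p` to `e` (identity on `⟨p, e⟩^⊥`), and its inverse
  `Plumbing.rotFrom p e = refl (p + e) ∘ refl e`;
* `Plumbing.plumbMap e (p, q) = (p', q')`, `p' = rotTo p e q`, `q' = rotFrom p' e p` — **the
  plumbing involution** of `Sᵏ × Sᵏ` at the pole `e`: on `D_e(c) = {⟪p, e⟫ > c, ⟪p, q⟫ > c}`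
  (`c > -1`… we use `0 ≤ c`) it is an involution exchanging the "base height" `⟪p, e⟫` and the
  "fibre height" `⟪p, q⟫` (`inner_plumbFst_pole`, `inner_plumbFst_plumbSnd`,
  `plumbMap_plumbMap`), smooth (`contMDiffOn_plumbMap`); packaged as a smooth open partial
  homeomorphism `Plumbing.plumbPH e c` of `Sᵏ × Sᵏ` with source = target = `D_e(c)`.

In the polar charts `(p, q) ↦ (P_e p, P_e (rotTo p e q))` (`P_e` the projection to `e^⊥`) of
`D_e(c) ≅ B × B` the map `plumbMap e` is exactly Kosinski's swap `(x, y) ↦ (y, x)`; the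
chart-free form is what makes the gluing, its smoothness and its symmetry elementary.
Everything is proved; no named facts (D-0026).

## References

* A. Kosinski, *Differential Manifolds*, Academic Press 1993, VI.11–VI.12 (plumbing, `M(4n)`,
  pp. 119–122). [Kosinski1993]
* J. Milnor, J. Stasheff, *Characteristic classes* (1974), §11, Lemma 11.5 (the normal bundle of
  the diagonal is the tangent bundle). [MilnorStasheff1974]
-/

open scoped Manifold ContDiff Topology RealInnerProductSpace
open Set Function Module

noncomputable section

namespace Literature.Topology.FourManifolds

namespace Plumbing

section InnerProductSpace

variable {E : Type*} [NormedAddCommGroup E] [InnerProductSpace ℝ E]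

/-! ### §1 Reflections -/

/-- The **reflection** in the hyperplane orthogonal to `v`: `x ↦ x - (2⟪v, x⟫/⟪v, v⟫) v` (the
identity for `v = 0`). [folklore] -/
def refl (v x : E) : E := x - (2 * ⟪v, x⟫ / ⟪v, v⟫) • v

/-- Formula. [folklore] -/
theorem refl_apply (v x : E) : refl v x = x - (2 * ⟪v, x⟫ / ⟪v, v⟫) • v := rfl

/-- `refl 0 = id`. [folklore] -/
@[simp] theorem refl_zero_left (x : E) : refl (0 : E) x = x := by simp [refl]

/-- `refl v` is additive. [folklore] -/
theorem refl_add (v x y : E) : refl v (x + y) = refl v x + refl v y := by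
  simp only [refl, inner_add_right]
  rw [show 2 * (⟪v, x⟫ + ⟪v, y⟫) / ⟪v, v⟫ = 2 * ⟪v, x⟫ / ⟪v, v⟫ + 2 * ⟪v, y⟫ / ⟪v, v⟫ by ring,
    add_smul]
  abel

/-- `refl v` commutes with scalars. [folklore] -/
theorem refl_smul_right (v : E) (c : ℝ) (x : E) : refl v (c • x) = c • refl v x := by
  simp only [refl, real_inner_smul_right, smul_sub, smul_smul]
  congr 2
  ring

/-- `refl v (-x) = - refl v x`. [folklore] -/
theorem refl_neg_right (v x : E) : refl v (-x) = -refl v x := by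
  rw [← neg_one_smul ℝ x, refl_smul_right, neg_one_smul]

/-- `refl v v = -v` (`v ≠ 0`). [folklore] -/
theorem refl_self {v : E} (hv : v ≠ 0) : refl v v = -v := by
  have h : ⟪v, v⟫ ≠ 0 := inner_self_ne_zero.mpr hv
  rw [refl, mul_div_assoc, div_self h, mul_one, two_smul]
  abel

/-- `refl v` fixes the vectors orthogonal to `v`. [folklore] -/
theorem refl_of_inner_eq_zero {v x : E} (h : ⟪v, x⟫ = 0) : refl v x = x := by
  simp [refl, h]

/-- `refl v` preserves inner products. [folklore] -/
theorem inner_refl_refl (v x y : E) : ⟪refl v x, refl v y⟫ = ⟪x, y⟫ := by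
  by_cases hv : v = 0
  · simp [refl, hv]
  have h : ⟪v, v⟫ ≠ 0 := inner_self_ne_zero.mpr hv
  simp only [refl, inner_sub_left, inner_sub_right, real_inner_smul_left, real_inner_smul_right,
    real_inner_comm v x]
  field_simp
  ring

/-- `refl v` preserves the norm. [folklore] -/
theorem norm_refl (v x : E) : ‖refl v x‖ = ‖x‖ := by
  have h := inner_refl_refl v x x
  rw [real_inner_self_eq_norm_sq, real_inner_self_eq_norm_sq] at h
  exact (sq_eq_sq₀ (norm_nonneg _) (norm_nonneg _)).1 h

/-- `refl v` is an involution. [folklore] -/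
theorem refl_refl (v x : E) : refl v (refl v x) = x := by
  by_cases hv : v = 0
  · simp [hv]
  have h : ⟪v, v⟫ ≠ 0 := inner_self_ne_zero.mpr hv
  have hc : 2 * ⟪v, refl v x⟫ / ⟪v, v⟫ = -(2 * ⟪v, x⟫ / ⟪v, v⟫) := by
    simp only [refl, inner_sub_right, real_inner_smul_right]
    field_simp
    ring
  conv_lhs => rw [refl_apply, hc]
  rw [refl_apply, neg_smul, sub_neg_eq_add, sub_add_cancel]

/-- `refl v` is injective. [folklore] -/
theorem refl_injective (v : E) : Injective (refl v) := fun x y hxy => by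
  rw [← refl_refl v x, hxy, refl_refl]

/-- **Smoothness of `(v, x) ↦ refl v x` off `v = 0`**, along smooth maps from a normed space.
[folklore] -/
theorem contDiffAt_refl {F : Type*} [NormedAddCommGroup F] [NormedSpace ℝ F] {n : WithTop ℕ∞}
    {f g : F → E} {y : F} (hf : ContDiffAt ℝ n f y) (hg : ContDiffAt ℝ n g y) (h0 : f y ≠ 0) :
    ContDiffAt ℝ n (fun z => refl (f z) (g z)) y := by
  unfold refl
  have hin : ContDiffAt ℝ n (fun z => ⟪f z, f z⟫) y := hf.inner ℝ hf
  have hne : ⟪f y, f y⟫ ≠ 0 := inner_self_ne_zero.mpr h0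
  exact hg.sub (((contDiffAt_const.mul (hf.inner ℝ hg)).div hin hne).smul hf)

/-- The reflection map on `E × E` is smooth at every `(v, x)` with `v ≠ 0`. [folklore] -/
theorem contDiffAt_refl_prod {n : WithTop ℕ∞} {vx : E × E} (h0 : vx.1 ≠ 0) :
    ContDiffAt ℝ n (fun z : E × E => refl z.1 z.2) vx :=
  contDiffAt_refl contDiffAt_fst contDiffAt_snd h0

/-! ### §2 Transport rotations -/

/-- **The transport rotation** `rotTo p e = refl e ∘ refl (p + e)`: for `‖p‖ = ‖e‖` and
`p ≠ -e` the rotation of the plane `⟨p, e⟩` taking `p` to `e`, the identity on `⟨p, e⟩^⊥`.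
[folklore] -/
def rotTo (p e x : E) : E := refl e (refl (p + e) x)

/-- The inverse transport rotation `rotFrom p e = refl (p + e) ∘ refl e` (taking `e` to `p`).
[folklore] -/
def rotFrom (p e x : E) : E := refl (p + e) (refl e x)

/-- `rotTo p e ∘ rotFrom p e = id`. [folklore] -/
@[simp] theorem rotTo_rotFrom (p e x : E) : rotTo p e (rotFrom p e x) = x := by
  simp [rotTo, rotFrom, refl_refl]

/-- `rotFrom p e ∘ rotTo p e = id`. [folklore] -/
@[simp] theorem rotFrom_rotTo (p e x : E) : rotFrom p e (rotTo p e x) = x := by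
  simp [rotTo, rotFrom, refl_refl]

/-- `rotTo p e` preserves inner products. [folklore] -/
theorem inner_rotTo_rotTo (p e x y : E) : ⟪rotTo p e x, rotTo p e y⟫ = ⟪x, y⟫ := by
  simp [rotTo, inner_refl_refl]

/-- `rotFrom p e` preserves inner products. [folklore] -/
theorem inner_rotFrom_rotFrom (p e x y : E) : ⟪rotFrom p e x, rotFrom p e y⟫ = ⟪x, y⟫ := by
  simp [rotFrom, inner_refl_refl]

/-- `rotTo p e` preserves the norm. [folklore] -/
theorem norm_rotTo (p e x : E) : ‖rotTo p e x‖ = ‖x‖ := by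
  simp [rotTo, norm_refl]

/-- `rotFrom p e` preserves the norm. [folklore] -/
theorem norm_rotFrom (p e x : E) : ‖rotFrom p e x‖ = ‖x‖ := by
  simp [rotFrom, norm_refl]

/-- For `‖p‖ = ‖e‖` and `p + e ≠ 0`: `refl (p + e) p = -e`. [folklore] -/
theorem refl_add_self_left {p e : E} (hpe : ‖p‖ = ‖e‖) (h0 : p + e ≠ 0) : refl (p + e) p = -e := by
  have h : ⟪p + e, p + e⟫ ≠ 0 := inner_self_ne_zero.mpr h0
  have hpp : ⟪p, p⟫ = ⟪e, e⟫ := by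
    rw [real_inner_self_eq_norm_sq, real_inner_self_eq_norm_sq, hpe]
  have hc : 2 * ⟪p + e, p⟫ / ⟪p + e, p + e⟫ = 1 := by
    rw [div_eq_one_iff_eq h]
    simp only [inner_add_left, inner_add_right, real_inner_comm p e, hpp]
    ring
  rw [refl, hc, one_smul]
  abel

/-- **`rotTo p e p = e`** (`‖p‖ = ‖e‖`, `p ≠ -e`). [folklore] -/
theorem rotTo_self {p e : E} (hpe : ‖p‖ = ‖e‖) (h0 : p + e ≠ 0) : rotTo p e p = e := by
  have he : e ≠ 0 := by
    rintro rfl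
    rw [norm_zero, norm_eq_zero] at hpe
    exact h0 (by rw [hpe, add_zero])
  rw [rotTo, refl_add_self_left hpe h0, refl_neg_right, refl_self he, neg_neg]

/-- **`rotFrom p e e = p`** (`‖p‖ = ‖e‖`, `p ≠ -e`). [folklore] -/
theorem rotFrom_pole {p e : E} (hpe : ‖p‖ = ‖e‖) (h0 : p + e ≠ 0) : rotFrom p e e = p :=
  calc rotFrom p e e = rotFrom p e (rotTo p e p) := by rw [rotTo_self hpe h0]
    _ = p := rotFrom_rotTo _ _ _

/-- `rotTo p p = id` (`p ≠ 0`). [folklore] -/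
theorem rotTo_self_self {p : E} (x : E) : rotTo p p x = x := by
  by_cases hp : p = 0
  · simp [rotTo, hp]
  have h2 : p + p = (2 : ℝ) • p := by rw [two_smul]
  rw [rotTo, h2]
  have : refl ((2 : ℝ) • p) x = refl p x := by
    simp only [refl, real_inner_smul_left, real_inner_smul_right, smul_smul]
    have h : ⟪p, p⟫ ≠ 0 := inner_self_ne_zero.mpr hp
    congr 1
    field_simp
  rw [this, refl_refl]

/-- Smoothness of `z ↦ rotTo (f z) (g z) (u z)` where `f z + g z ≠ 0`, `g z ≠ 0`. [folklore] -/
theorem contDiffAt_rotTo {F : Type*} [NormedAddCommGroup F] [NormedSpace ℝ F] {n : WithTop ℕ∞}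
    {f g u : F → E} {y : F} (hf : ContDiffAt ℝ n f y) (hg : ContDiffAt ℝ n g y)
    (hu : ContDiffAt ℝ n u y) (h0 : f y + g y ≠ 0) (hg0 : g y ≠ 0) :
    ContDiffAt ℝ n (fun z => rotTo (f z) (g z) (u z)) y :=
  contDiffAt_refl hg (contDiffAt_refl (hf.add hg) hu h0) hg0

/-- Smoothness of `z ↦ rotFrom (f z) (g z) (u z)` where `f z + g z ≠ 0`, `g z ≠ 0`. [folklore] -/
theorem contDiffAt_rotFrom {F : Type*} [NormedAddCommGroup F] [NormedSpace ℝ F] {n : WithTop ℕ∞}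
    {f g u : F → E} {y : F} (hf : ContDiffAt ℝ n f y) (hg : ContDiffAt ℝ n g y)
    (hu : ContDiffAt ℝ n u y) (h0 : f y + g y ≠ 0) (hg0 : g y ≠ 0) :
    ContDiffAt ℝ n (fun z => rotFrom (f z) (g z) (u z)) y :=
  contDiffAt_refl (hf.add hg) (contDiffAt_refl hg hu hg0) h0

end InnerProductSpace

/-! ### §3 The plumbing involution of `Sᵏ × Sᵏ` at a pole -/

section Sphere

/-- Local notation: `𝔼 n` is the model Euclidean space `EuclideanSpace ℝ (Fin n)`. -/
local notation "𝔼 " n:arg => EuclideanSpace ℝ (Fin n)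

/-- Local notation: `𝕊 n` is the unit sphere in `EuclideanSpace ℝ (Fin (n + 1))`. -/
local notation "𝕊 " n:arg => (Metric.sphere (0 : EuclideanSpace ℝ (Fin (n + 1))) 1)

variable {k : ℕ}

/-- `dim ℝᵏ⁺¹ = k + 1` as a `Fact` (for Mathlib's sphere instances). [folklore] -/
instance instFactFinrankSucc : Fact (finrank ℝ (𝔼 (k + 1)) = k + 1) := ⟨finrank_euclideanSpace_fin⟩

/-- Unit vectors with `⟪p, e⟫ > -1` are not antipodal: `p + e ≠ 0`. [folklore] -/
theorem add_ne_zero_of_neg_one_lt_inner {p e : 𝔼 (k + 1)} (he : ‖e‖ = 1)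
    (h : -1 < ⟪p, e⟫) : p + e ≠ 0 := by
  intro h0
  have hp : p = -e := eq_neg_of_add_eq_zero_left h0
  rw [hp, inner_neg_left, real_inner_self_eq_norm_sq, he] at h
  norm_num at h

/-- A unit vector is not zero. [folklore] -/
theorem coe_sphere_ne_zero (e : 𝕊 k) : (e : 𝔼 (k + 1)) ≠ 0 :=
  ne_zero_of_mem_unit_sphere e

/-- **First component of the plumbing map**: `p' = rotTo p e q`, the fibre point transported
to the base by the rotation taking the base point `p` to the pole `e`. [cite: Kosinski1993, VI.12 p. 120] -/
def plumbFst (e : 𝕊 k) (pq : (𝕊 k) × (𝕊 k)) : 𝕊 k :=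
  ⟨rotTo (pq.1 : 𝔼 (k + 1)) e pq.2, by
    rw [mem_sphere_zero_iff_norm, norm_rotTo, norm_eq_of_mem_sphere pq.2]⟩

/-- Coordinates of `plumbFst`. [folklore] -/
@[simp] theorem coe_plumbFst (e : 𝕊 k) (pq : (𝕊 k) × (𝕊 k)) :
    (plumbFst e pq : 𝔼 (k + 1)) = rotTo (pq.1 : 𝔼 (k + 1)) e pq.2 := rfl

/-- **Second component of the plumbing map**: `q' = rotFrom p' e p`, the base point transported
to the fibre over `p'`. [cite: Kosinski1993, VI.12 p. 120] -/
def plumbSnd (e : 𝕊 k) (pq : (𝕊 k) × (𝕊 k)) : 𝕊 k :=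
  ⟨rotFrom (plumbFst e pq : 𝔼 (k + 1)) e pq.1, by
    rw [mem_sphere_zero_iff_norm, norm_rotFrom, norm_eq_of_mem_sphere pq.1]⟩

/-- Coordinates of `plumbSnd`. [folklore] -/
@[simp] theorem coe_plumbSnd (e : 𝕊 k) (pq : (𝕊 k) × (𝕊 k)) :
    (plumbSnd e pq : 𝔼 (k + 1)) = rotFrom (plumbFst e pq : 𝔼 (k + 1)) e pq.1 := rfl

/-- **The plumbing map of `Sᵏ × Sᵏ` at the pole `e`**, `(p, q) ↦ (rotTo p e q, rotFrom p' e p)`: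
Kosinski's interchange of base and fibre coordinates `(x, y) ↦ (y, x)` (VI.12, p. 120) written
with transport rotations. [cite: Kosinski1993, VI.12 p. 120] -/
def plumbMap (e : 𝕊 k) (pq : (𝕊 k) × (𝕊 k)) : (𝕊 k) × (𝕊 k) :=
  (plumbFst e pq, plumbSnd e pq)

/-- First component of `plumbMap`. [folklore] -/
@[simp] theorem plumbMap_fst (e : 𝕊 k) (pq : (𝕊 k) × (𝕊 k)) : (plumbMap e pq).1 = plumbFst e pq := rfl

/-- Second component of `plumbMap`. [folklore] -/
@[simp] theorem plumbMap_snd (e : 𝕊 k) (pq : (𝕊 k) × (𝕊 k)) : (plumbMap e pq).2 = plumbSnd e pq := rfl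

/-- **The plumbing map is an involution** (on all of `Sᵏ × Sᵏ`):
`rotTo p' e (rotFrom p' e p) = p` and `rotFrom p e (rotTo p e q) = q`. [folklore] -/
theorem plumbMap_plumbMap (e : 𝕊 k) (pq : (𝕊 k) × (𝕊 k)) : plumbMap e (plumbMap e pq) = pq := by
  obtain ⟨p, q⟩ := pq
  have h1 : plumbFst e (plumbMap e (p, q)) = p := by
    apply Subtype.ext
    simp [plumbMap]
  refine Prod.ext h1 ?_
  apply Subtype.ext
  rw [plumbMap_snd, coe_plumbSnd, h1]
  simp [plumbMap]

/-- The plumbing map is a bijection of `Sᵏ × Sᵏ`. [folklore] -/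
theorem plumbMap_involutive (e : 𝕊 k) : Involutive (plumbMap e) := plumbMap_plumbMap e

/-- **The base height of the image is the fibre height**: `⟪p', e⟫ = ⟪p, q⟫` (`p ≠ -e`).
[cite: Kosinski1993, VI.12 p. 120] -/
theorem inner_plumbFst_pole (e : 𝕊 k) {pq : (𝕊 k) × (𝕊 k)}
    (h : -1 < ⟪(pq.1 : 𝔼 (k + 1)), (e : 𝔼 (k + 1))⟫) :
    ⟪(plumbFst e pq : 𝔼 (k + 1)), (e : 𝔼 (k + 1))⟫ = ⟪(pq.1 : 𝔼 (k + 1)), (pq.2 : 𝔼 (k + 1))⟫ := by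
  have hpe : ‖(pq.1 : 𝔼 (k + 1))‖ = ‖(e : 𝔼 (k + 1))‖ := by
    rw [norm_eq_of_mem_sphere pq.1, norm_eq_of_mem_sphere e]
  have h0 := add_ne_zero_of_neg_one_lt_inner (norm_eq_of_mem_sphere e) h
  rw [coe_plumbFst]
  have h1 : ⟪rotTo (pq.1 : 𝔼 (k + 1)) e pq.2, (e : 𝔼 (k + 1))⟫ =
      ⟪rotTo (pq.1 : 𝔼 (k + 1)) e pq.2, rotTo (pq.1 : 𝔼 (k + 1)) e pq.1⟫ := by
    rw [rotTo_self hpe h0]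
  rw [h1, inner_rotTo_rotTo, real_inner_comm]

/-- **The fibre height of the image is the base height**: `⟪p', q'⟫ = ⟪p, e⟫`
(`p ≠ -e`, `⟪p, q⟫ > -1`). [cite: Kosinski1993, VI.12 p. 120] -/
theorem inner_plumbFst_plumbSnd (e : 𝕊 k) {pq : (𝕊 k) × (𝕊 k)}
    (h : -1 < ⟪(pq.1 : 𝔼 (k + 1)), (e : 𝔼 (k + 1))⟫)
    (h' : -1 < ⟪(pq.1 : 𝔼 (k + 1)), (pq.2 : 𝔼 (k + 1))⟫) :
    ⟪(plumbFst e pq : 𝔼 (k + 1)), (plumbSnd e pq : 𝔼 (k + 1))⟫ =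
      ⟪(pq.1 : 𝔼 (k + 1)), (e : 𝔼 (k + 1))⟫ := by
  have hpe : ‖(plumbFst e pq : 𝔼 (k + 1))‖ = ‖(e : 𝔼 (k + 1))‖ := by
    rw [norm_eq_of_mem_sphere (plumbFst e pq), norm_eq_of_mem_sphere e]
  have h1 : -1 < ⟪(plumbFst e pq : 𝔼 (k + 1)), (e : 𝔼 (k + 1))⟫ := by
    rw [inner_plumbFst_pole e h]; exact h'
  have h0 := add_ne_zero_of_neg_one_lt_inner (norm_eq_of_mem_sphere e) h1
  set p' : 𝔼 (k + 1) := (plumbFst e pq : 𝔼 (k + 1)) with hp'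
  calc ⟪p', (plumbSnd e pq : 𝔼 (k + 1))⟫
        = ⟪rotTo p' e p', rotTo p' e (plumbSnd e pq : 𝔼 (k + 1))⟫ := (inner_rotTo_rotTo _ _ _ _).symm
    _ = ⟪(e : 𝔼 (k + 1)), (pq.1 : 𝔼 (k + 1))⟫ := by rw [rotTo_self hpe h0, coe_plumbSnd, rotTo_rotFrom]
    _ = ⟪(pq.1 : 𝔼 (k + 1)), (e : 𝔼 (k + 1))⟫ := real_inner_comm _ _

/-- The base height `⟪p, e⟫` of a point of `Sᵏ × Sᵏ` relative to the pole `e`. [folklore] -/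
def baseHt (e : 𝕊 k) (pq : (𝕊 k) × (𝕊 k)) : ℝ := ⟪(pq.1 : 𝔼 (k + 1)), (e : 𝔼 (k + 1))⟫

/-- The fibre height `⟪p, q⟫` of a point of `Sᵏ × Sᵏ` (cosine of the spherical distance from the
diagonal). [folklore] -/
def fibHt (pq : (𝕊 k) × (𝕊 k)) : ℝ := ⟪(pq.1 : 𝔼 (k + 1)), (pq.2 : 𝔼 (k + 1))⟫

/-- Formula for `baseHt`. [folklore] -/
theorem baseHt_apply (e : 𝕊 k) (pq : (𝕊 k) × (𝕊 k)) :
    baseHt e pq = ⟪(pq.1 : 𝔼 (k + 1)), (e : 𝔼 (k + 1))⟫ := rfl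

/-- Formula for `fibHt`. [folklore] -/
theorem fibHt_apply (pq : (𝕊 k) × (𝕊 k)) :
    fibHt pq = ⟪(pq.1 : 𝔼 (k + 1)), (pq.2 : 𝔼 (k + 1))⟫ := rfl

/-- `|⟪p, e⟫| ≤ 1`. [folklore] -/
theorem abs_baseHt_le_one (e : 𝕊 k) (pq : (𝕊 k) × (𝕊 k)) : |baseHt e pq| ≤ 1 := by
  have h := abs_real_inner_le_norm (pq.1 : 𝔼 (k + 1)) (e : 𝔼 (k + 1))
  rwa [norm_eq_of_mem_sphere pq.1, norm_eq_of_mem_sphere e, one_mul] at h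

/-- `|⟪p, q⟫| ≤ 1`. [folklore] -/
theorem abs_fibHt_le_one (pq : (𝕊 k) × (𝕊 k)) : |fibHt pq| ≤ 1 := by
  have h := abs_real_inner_le_norm (pq.1 : 𝔼 (k + 1)) (pq.2 : 𝔼 (k + 1))
  rwa [norm_eq_of_mem_sphere pq.1, norm_eq_of_mem_sphere pq.2, one_mul] at h

/-- `baseHt e ∘ plumbMap e = fibHt` where `⟪p, e⟫ > -1`. [cite: Kosinski1993, VI.12 p. 120] -/
theorem baseHt_plumbMap (e : 𝕊 k) {pq : (𝕊 k) × (𝕊 k)} (h : -1 < baseHt e pq) :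
    baseHt e (plumbMap e pq) = fibHt pq :=
  inner_plumbFst_pole e h

/-- `fibHt ∘ plumbMap e = baseHt e` where `⟪p, e⟫ > -1`, `⟪p, q⟫ > -1`. [cite: Kosinski1993, VI.12 p. 120] -/
theorem fibHt_plumbMap (e : 𝕊 k) {pq : (𝕊 k) × (𝕊 k)} (h : -1 < baseHt e pq) (h' : -1 < fibHt pq) :
    fibHt (plumbMap e pq) = baseHt e pq :=
  inner_plumbFst_plumbSnd e h h'

/-- **The plumbing domain** `D_e(c) = {⟪p, e⟫ > c, ⟪p, q⟫ > c}` at the pole `e`: the part of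
the tube `{⟪p, q⟫ > c}` lying over the cap `{⟪p, e⟫ > c}` of the base. [cite: Kosinski1993, VI.12 p. 120] -/
def plumbDom (e : 𝕊 k) (c : ℝ) : Set ((𝕊 k) × (𝕊 k)) := {pq | c < baseHt e pq ∧ c < fibHt pq}

/-- Membership in the plumbing domain. [folklore] -/
theorem mem_plumbDom {e : 𝕊 k} {c : ℝ} {pq : (𝕊 k) × (𝕊 k)} :
    pq ∈ plumbDom e c ↔ c < baseHt e pq ∧ c < fibHt pq := Iff.rfl

/-- `baseHt` is continuous. [folklore] -/
theorem continuous_baseHt (e : 𝕊 k) : Continuous (baseHt e) := by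
  unfold baseHt; fun_prop

/-- `fibHt` is continuous. [folklore] -/
theorem continuous_fibHt : Continuous (fibHt (k := k)) := by
  unfold fibHt; fun_prop

/-- The plumbing domain is open. [folklore] -/
theorem isOpen_plumbDom (e : 𝕊 k) (c : ℝ) : IsOpen (plumbDom e c) :=
  (isOpen_lt continuous_const (continuous_baseHt e)).inter (isOpen_lt continuous_const continuous_fibHt)

/-- **The plumbing map preserves the plumbing domain** (`c ≥ -1`), exchanging the two heights.
[cite: Kosinski1993, VI.12 p. 120] -/
theorem mapsTo_plumbMap (e : 𝕊 k) {c : ℝ} (hc : -1 ≤ c) : MapsTo (plumbMap e) (plumbDom e c) (plumbDom e c) := by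
  intro pq hpq
  have h1 : -1 < baseHt e pq := lt_of_le_of_lt hc hpq.1
  have h2 : -1 < fibHt pq := lt_of_le_of_lt hc hpq.2
  refine ⟨?_, ?_⟩
  · rw [baseHt_plumbMap e h1]; exact hpq.2
  · rw [fibHt_plumbMap e h1 h2]; exact hpq.1

/-- The larger open set `U_e = {⟪p, e⟫ > -1, ⟪p, q⟫ > -1}` on which the plumbing map is smooth.
[folklore] -/
theorem plumbDom_neg_one_eq (e : 𝕊 k) :
    plumbDom e (-1) = {pq | -1 < baseHt e pq ∧ -1 < fibHt pq} := rfl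

/-! #### Smoothness -/

section Smooth

variable {M : Type*} [TopologicalSpace M] {H : Type*} [TopologicalSpace H] {F : Type*}
  [NormedAddCommGroup F] [NormedSpace ℝ F] {I : ModelWithCorners ℝ F H} [ChartedSpace H M]

/-- A map into the sphere which is `C^m` into the ambient space on an OPEN set is `C^m` into the
sphere on that set (the `ContMDiffOn` form of Mathlib's `ContMDiff.codRestrict_sphere`).
[folklore] -/
theorem contMDiffOn_codRestrict_sphere {m : WithTop ℕ∞} [IsManifold I m M] {f : M → 𝔼 (k + 1)}
    {s : Set M} (hs : IsOpen s) (hf : ContMDiffOn I 𝓘(ℝ, 𝔼 (k + 1)) m f s)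
    (hf' : ∀ x, f x ∈ Metric.sphere (0 : 𝔼 (k + 1)) 1) :
    ContMDiffOn I (𝓡 k) m (Set.codRestrict f _ hf') s := by
  intro x hx
  let U : TopologicalSpace.Opens M := ⟨s, hs⟩
  have h1 : ContMDiff I 𝓘(ℝ, 𝔼 (k + 1)) m (fun y : U => f y) :=
    hf.comp_contMDiff contMDiff_subtype_val (fun y => y.2)
  have h2 : ContMDiff I (𝓡 k) m (Set.codRestrict (fun y : U => f y) _ (fun y => hf' y)) :=
    h1.codRestrict_sphere _
  have h3 : ContMDiffAt I (𝓡 k) m (fun y : U => Set.codRestrict f _ hf' y) ⟨x, hx⟩ := h2.contMDiffAt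
  exact (contMDiffAt_subtype_iff.1 h3).contMDiffWithinAt

end Smooth

/-- The coordinate map `Sᵏ × Sᵏ → ℝᵏ⁺¹ × ℝᵏ⁺¹` is smooth. [folklore] -/
theorem contMDiff_coe_prod :
    ContMDiff ((𝓡 k).prod (𝓡 k)) 𝓘(ℝ, 𝔼 (k + 1) × 𝔼 (k + 1)) ∞
      (fun pq : (𝕊 k) × (𝕊 k) => ((pq.1 : 𝔼 (k + 1)), (pq.2 : 𝔼 (k + 1)))) :=
  (contMDiff_coe_sphere.comp contMDiff_fst).prodMk_space (contMDiff_coe_sphere.comp contMDiff_snd)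

/-- `baseHt` is smooth. [folklore] -/
theorem contMDiff_baseHt (e : 𝕊 k) : ContMDiff ((𝓡 k).prod (𝓡 k)) 𝓘(ℝ, ℝ) ∞ (baseHt e) := by
  have h : ContDiff ℝ ∞ fun z : 𝔼 (k + 1) × 𝔼 (k + 1) => ⟪z.1, (e : 𝔼 (k + 1))⟫ :=
    contDiff_fst.inner ℝ contDiff_const
  exact h.comp_contMDiff contMDiff_coe_prod

/-- `fibHt` is smooth. [folklore] -/
theorem contMDiff_fibHt : ContMDiff ((𝓡 k).prod (𝓡 k)) 𝓘(ℝ, ℝ) ∞ (fibHt (k := k)) := by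
  have h : ContDiff ℝ ∞ fun z : 𝔼 (k + 1) × 𝔼 (k + 1) => ⟪z.1, z.2⟫ := contDiff_fst.inner ℝ contDiff_snd
  exact h.comp_contMDiff contMDiff_coe_prod

/-- The first plumbing coordinate is smooth into `ℝᵏ⁺¹` at every `(p, q)` with `p ≠ -e`. [folklore] -/
theorem contMDiffAt_coe_plumbFst (e : 𝕊 k) {pq : (𝕊 k) × (𝕊 k)} (h : -1 < baseHt e pq) :
    ContMDiffAt ((𝓡 k).prod (𝓡 k)) 𝓘(ℝ, 𝔼 (k + 1)) ∞
      (fun x : (𝕊 k) × (𝕊 k) => (plumbFst e x : 𝔼 (k + 1))) pq := by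
  have h0 := add_ne_zero_of_neg_one_lt_inner (norm_eq_of_mem_sphere e) h
  have hg : ContDiffAt ℝ ∞ (fun z : 𝔼 (k + 1) × 𝔼 (k + 1) => rotTo z.1 (e : 𝔼 (k + 1)) z.2)
      ((pq.1 : 𝔼 (k + 1)), (pq.2 : 𝔼 (k + 1))) :=
    contDiffAt_rotTo contDiffAt_fst contDiffAt_const contDiffAt_snd h0 (coe_sphere_ne_zero e)
  exact hg.comp_contMDiffAt (f := fun x : (𝕊 k) × (𝕊 k) => ((x.1 : 𝔼 (k + 1)), (x.2 : 𝔼 (k + 1))))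
    (x := pq) contMDiff_coe_prod.contMDiffAt

/-- The second plumbing coordinate is smooth into `ℝᵏ⁺¹` at every `(p, q)` with `p ≠ -e`,
`⟪p, q⟫ > -1`. [folklore] -/
theorem contMDiffAt_coe_plumbSnd (e : 𝕊 k) {pq : (𝕊 k) × (𝕊 k)} (h : -1 < baseHt e pq)
    (h' : -1 < fibHt pq) :
    ContMDiffAt ((𝓡 k).prod (𝓡 k)) 𝓘(ℝ, 𝔼 (k + 1)) ∞
      (fun x : (𝕊 k) × (𝕊 k) => (plumbSnd e x : 𝔼 (k + 1))) pq := by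
  have h1 : -1 < ⟪(plumbFst e pq : 𝔼 (k + 1)), (e : 𝔼 (k + 1))⟫ := by
    rw [inner_plumbFst_pole e h]; exact h'
  have h0 := add_ne_zero_of_neg_one_lt_inner (norm_eq_of_mem_sphere e) h1
  have hF : ContMDiffAt ((𝓡 k).prod (𝓡 k)) 𝓘(ℝ, 𝔼 (k + 1) × 𝔼 (k + 1)) ∞
      (fun x : (𝕊 k) × (𝕊 k) => ((plumbFst e x : 𝔼 (k + 1)), (x.1 : 𝔼 (k + 1)))) pq :=
    (contMDiffAt_coe_plumbFst e h).prodMk_space (contMDiff_coe_sphere.comp contMDiff_fst).contMDiffAt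
  have hg : ContDiffAt ℝ ∞ (fun z : 𝔼 (k + 1) × 𝔼 (k + 1) => rotFrom z.1 (e : 𝔼 (k + 1)) z.2)
      ((plumbFst e pq : 𝔼 (k + 1)), (pq.1 : 𝔼 (k + 1))) :=
    contDiffAt_rotFrom contDiffAt_fst contDiffAt_const contDiffAt_snd h0 (coe_sphere_ne_zero e)
  exact hg.comp_contMDiffAt
    (f := fun x : (𝕊 k) × (𝕊 k) => ((plumbFst e x : 𝔼 (k + 1)), (x.1 : 𝔼 (k + 1)))) (x := pq) hF

/-- **The plumbing map is smooth on `U_e = D_e(-1)`** (where `p ≠ -e` and `q ≠ -p`).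
[cite: Kosinski1993, VI.12 p. 120] -/
theorem contMDiffOn_plumbMap (e : 𝕊 k) :
    ContMDiffOn ((𝓡 k).prod (𝓡 k)) ((𝓡 k).prod (𝓡 k)) ∞ (plumbMap e) (plumbDom e (-1)) := by
  have h1 : ContMDiffOn ((𝓡 k).prod (𝓡 k)) (𝓡 k) ∞ (plumbFst e) (plumbDom e (-1)) := by
    have := contMDiffOn_codRestrict_sphere (I := (𝓡 k).prod (𝓡 k)) (isOpen_plumbDom e (-1))
      (f := fun x : (𝕊 k) × (𝕊 k) => (plumbFst e x : 𝔼 (k + 1)))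
      (fun x hx => (contMDiffAt_coe_plumbFst e hx.1).contMDiffWithinAt) (fun x => (plumbFst e x).2)
    exact this
  have h2 : ContMDiffOn ((𝓡 k).prod (𝓡 k)) (𝓡 k) ∞ (plumbSnd e) (plumbDom e (-1)) := by
    have := contMDiffOn_codRestrict_sphere (I := (𝓡 k).prod (𝓡 k)) (isOpen_plumbDom e (-1))
      (f := fun x : (𝕊 k) × (𝕊 k) => (plumbSnd e x : 𝔼 (k + 1)))
      (fun x hx => (contMDiffAt_coe_plumbSnd e hx.1 hx.2).contMDiffWithinAt) (fun x => (plumbSnd e x).2)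
    exact this
  exact h1.prodMk h2

/-- The plumbing map is continuous on `U_e`. [folklore] -/
theorem continuousOn_plumbMap (e : 𝕊 k) : ContinuousOn (plumbMap e) (plumbDom e (-1)) :=
  (contMDiffOn_plumbMap e).continuousOn

/-- **The plumbing map as a smooth open partial homeomorphism** of `Sᵏ × Sᵏ` with
source = target = `D_e(c)` (`c ≥ -1`), its own inverse. [cite: Kosinski1993, VI.12 p. 120] -/
def plumbPH (e : 𝕊 k) {c : ℝ} (hc : -1 ≤ c) : OpenPartialHomeomorph ((𝕊 k) × (𝕊 k)) ((𝕊 k) × (𝕊 k)) where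
  toFun := plumbMap e
  invFun := plumbMap e
  source := plumbDom e c
  target := plumbDom e c
  map_source' := mapsTo_plumbMap e hc
  map_target' := mapsTo_plumbMap e hc
  left_inv' := fun _ _ => plumbMap_plumbMap e _
  right_inv' := fun _ _ => plumbMap_plumbMap e _
  open_source := isOpen_plumbDom e c
  open_target := isOpen_plumbDom e c
  continuousOn_toFun := (continuousOn_plumbMap e).mono fun _ hpq =>
    ⟨lt_of_le_of_lt hc hpq.1, lt_of_le_of_lt hc hpq.2⟩
  continuousOn_invFun := (continuousOn_plumbMap e).mono fun _ hpq =>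
    ⟨lt_of_le_of_lt hc hpq.1, lt_of_le_of_lt hc hpq.2⟩

/-- `plumbPH` is `plumbMap` as a function. [folklore] -/
@[simp] theorem coe_plumbPH (e : 𝕊 k) {c : ℝ} (hc : -1 ≤ c) :
    (plumbPH e hc : (𝕊 k) × (𝕊 k) → (𝕊 k) × (𝕊 k)) = plumbMap e := rfl

/-- The inverse of `plumbPH` is `plumbMap` as a function. [folklore] -/
@[simp] theorem coe_plumbPH_symm (e : 𝕊 k) {c : ℝ} (hc : -1 ≤ c) :
    ((plumbPH e hc).symm : (𝕊 k) × (𝕊 k) → (𝕊 k) × (𝕊 k)) = plumbMap e := rfl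

/-- The source of `plumbPH` is the plumbing domain. [folklore] -/
@[simp] theorem plumbPH_source (e : 𝕊 k) {c : ℝ} (hc : -1 ≤ c) : (plumbPH e hc).source = plumbDom e c := rfl

/-- The target of `plumbPH` is the plumbing domain. [folklore] -/
@[simp] theorem plumbPH_target (e : 𝕊 k) {c : ℝ} (hc : -1 ≤ c) : (plumbPH e hc).target = plumbDom e c := rfl

/-- The plumbing partial homeomorphism is smooth on its source. [cite: Kosinski1993, VI.12 p. 120] -/
theorem contMDiffOn_plumbPH (e : 𝕊 k) {c : ℝ} (hc : -1 ≤ c) :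
    ContMDiffOn ((𝓡 k).prod (𝓡 k)) ((𝓡 k).prod (𝓡 k)) ∞ (plumbPH e hc) (plumbPH e hc).source :=
  (contMDiffOn_plumbMap e).mono fun _ hpq => ⟨lt_of_le_of_lt hc hpq.1, lt_of_le_of_lt hc hpq.2⟩

/-- The inverse plumbing partial homeomorphism is smooth on its source. [cite: Kosinski1993, VI.12 p. 120] -/
theorem contMDiffOn_plumbPH_symm (e : 𝕊 k) {c : ℝ} (hc : -1 ≤ c) :
    ContMDiffOn ((𝓡 k).prod (𝓡 k)) ((𝓡 k).prod (𝓡 k)) ∞ (plumbPH e hc).symm (plumbPH e hc).target :=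
  (contMDiffOn_plumbMap e).mono fun _ hpq => ⟨lt_of_le_of_lt hc hpq.1, lt_of_le_of_lt hc hpq.2⟩

end Sphere

end Plumbing

end Literature.Topology.FourManifolds
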